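import Mathlib
import HarnessLib
import Summits.AtomisticToContinuum.Crystallization.Theorems.FrustratedLawDichotomyTwoShellRigidityLsFitReplaySound3

/-!
# Two-shell rigidity, slot 3 · the `SphericalLsFit` replay engine (4b): the geometry of a leaf (`fit_geometry`)
# (decomp-a2c, lens 3, gen 37 — NODE «SphericalLsFitReplay»; mechanical split of part (4) for the 400-line rule)

From the certified `LeafBounds` of a configuration `p : Fin 12 → ℝ³` (frame coordinates `X`, leaf frame `R = M/n`
from the quaternion) to the four REAL conclusions of `SphericalLsFit` for the labelled dozen: with the isometry
`A := (colBasis R)⁻¹ ∘ (frameBasis)⁻¹` and the labelled residual `r i = A⁻¹ (p i) − uᵢ` (`uᵢ = patPt m i = tab i/√N`):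
(F0) `‖r i‖ ≤ α`; (F1) `‖lsRotL r‖ ≤ Ω`; (F2) `⟪m/√k, rᵢ − lsRotL r × uᵢ⟫ ≤ V₁` for every probe of the table;
(F3) the same for differences over bonded pairs, `≤ V₃`.  Dictionary lemmas in part (4a) `…LsFitReplaySound3`.
`[folklore]`; no `sorry`; no `instance`/`notation`; no data.
-/

namespace Summit.AtomisticToContinuum.Crystallization.Theorems

namespace Rig

open Literature.Geometry.DiscreteGeometry
open Literature.Analysis.ValidatedNumerics.NumericsMP
open Summit.AtomisticToContinuum.Crystallization.Theorems.FrustratedLawDichotomyTwoShellRigidityLsLedger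
open Summit.AtomisticToContinuum.Crystallization.Theorems.FrustratedLawDichotomyTwoShellRigidityCut (E3)
open Summit.AtomisticToContinuum.Crystallization.Theorems.FrustratedLawDichotomyTwoShellRigidityGaugedLadder
open scoped RealInnerProductSpace

/-! ### The geometry of a leaf -/

/-- **From certified leaf bounds to the four real conclusions** (F0)–(F3) for a labelled dozen
`p` with frame coordinates `X` (in an orthonormal basis `bE`), under the integer parameter
hypotheses linking `(F0L, OM2, V1K, V3K)` to `(α, Ω, V₁, V₃)`. -/
theorem fit_geometry {m : Model} (hN : 0 < m.normSq) (htab : ∀ i, dotZ (m.tab i) (m.tab i) = m.normSq)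
    {prm : FitPrm} {p : Fin 12 → E3} (hp1 : ∀ i, ‖p i‖ = 1)
    (bE : OrthonormalBasis (Fin 3) ℝ E3) (X : Fin 12 → Fin 3 → ℝ)
    (hX : ∀ i, bE.repr (p i) = WithLp.toLp 2 (X i))
    {qw qx qy qz : ℤ} {refl : Bool}
    (hL : LeafBounds m prm (quatMat qw qx qy qz refl) (quatNorm qw qx qy qz) X)
    {α Ω V₁ V₃ : ℝ} (hα : 0 ≤ α) (hΩ : 0 ≤ Ω)
    (hF0 : (SC : ℝ) * Real.sqrt m.normSq * (1 - α ^ 2 / 2) ≤ prm.F0L)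
    (hOM : (prm.OM2 : ℝ) ≤ 64 * m.normSq * Ω ^ 2 * (SC : ℝ) ^ 2)
    (hV1 : ∀ k, kOK k = true → (prm.V1K.getK k : ℝ) ≤ 8 * m.normSq * SC * Real.sqrt k * V₁)
    (hV3 : ∀ k, kOK k = true → (prm.V3K.getK k : ℝ) ≤ 8 * m.normSq * SC * Real.sqrt k * V₃) :
    ∃ A : E3 ≃ₗᵢ[ℝ] E3,
      (∀ i, ‖A.symm (p i) - patPt m i‖ ≤ α) ∧
      ‖lsRotL m (fun i => A.symm (p i) - patPt m i)‖ ≤ Ω ∧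
      (∀ e ∈ prm.ptab, ∀ i, ⟪probeVec e, derotL m (fun i => A.symm (p i) - patPt m i) i⟫ ≤ V₁) ∧
      (∀ e ∈ prm.ptab, ∀ q ∈ bondPairs m,
        ⟪probeVec e, derotL m (fun i => A.symm (p i) - patPt m i) q.1 -
          derotL m (fun i => A.symm (p i) - patPt m i) q.2⟫ ≤ V₃) := by
  -- names
  set Mq := quatMat qw qx qy qz refl with hMq
  set n := quatNorm qw qx qy qz with hn
  have hn0 : (0 : ℝ) < n := by exact_mod_cast hL.npos
  set sN := Real.sqrt m.normSq with hsN
  have hNr : (0 : ℝ) < m.normSq := by exact_mod_cast hN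
  have hsN0 : 0 < sN := Real.sqrt_pos.2 hNr
  have hsN2 : sN ^ 2 = (m.normSq : ℝ) := Real.sq_sqrt hNr.le
  have hS0 : (0 : ℝ) < SC := by rw [SC]; norm_num
  -- the leaf frame and the isometry
  have hR := quatR_orth refl hL.npos
  have hRe : ∀ k l, quatR qw qx qy qz refl k l = (Mq k l : ℝ) / n := fun k l => rfl
  let cB := colBasis (quatR qw qx qy qz refl) hR
  have hcB1 : ∀ (v : E3) (l : Fin 3), (cB.repr v) l = ∑ k, quatR qw qx qy qz refl k l * v k :=
    fun v l => colBasis_repr_apply _ hR v l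
  have hcB2 : ∀ (v : E3) (k : Fin 3), (cB.repr.symm v) k = ∑ l, quatR qw qx qy qz refl k l * v l :=
    fun v k => colBasis_repr_symm_apply _ hR v k
  let A : E3 ≃ₗᵢ[ℝ] E3 := cB.repr.symm.trans bE.repr.symm
  have hpi : ∀ i, p i = bE.repr.symm (WithLp.toLp 2 (X i)) := fun i => by
    rw [← hX i, LinearIsometryEquiv.symm_apply_apply]
  have hAs : ∀ i, A.symm (p i) = cB.repr (WithLp.toLp 2 (X i)) := fun i => by
    apply A.injective
    rw [LinearIsometryEquiv.apply_symm_apply]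
    show p i = bE.repr.symm (cB.repr.symm (cB.repr (WithLp.toLp 2 (X i))))
    rw [LinearIsometryEquiv.symm_apply_apply, hpi i]
  refine ⟨A, ?_⟩
  set r : Fin 12 → E3 := fun i => A.symm (p i) - patPt m i with hrdef
  -- coordinates of the residual
  have hrc : ∀ i l, (r i) l = (∑ k, quatR qw qx qy qz refl k l * X i k) - (m.tab i l : ℝ) / sN := by
    intro i l
    show (A.symm (p i) - patPt m i) l = _
    rw [PiLp.sub_apply, hAs i, hcB1, patPt_apply']
  -- (F0): ⟪p i, A uᵢ⟫ · n √N = F0ᵢ(X)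
  have hF0i : ∀ i, ⟪p i, A (patPt m i)⟫ * (n * sN) = fval (fitObj0 m Mq i) X := by
    intro i
    have hA : A (patPt m i) = bE.repr.symm (cB.repr.symm (patPt m i)) := rfl
    rw [hA, hpi i, LinearIsometryEquiv.inner_map_map, inner_fin3, fval_fitObj0, hcB2, hcB2, hcB2]
    simp only [Fin.sum_univ_three, mulVecZ, hRe, patPt_apply']
    push_cast
    field_simp
    ring
  have hG0 : ∀ i, ‖r i‖ ≤ α := by
    intro i
    have hu1 : ‖patPt m i‖ = 1 := by
      have h2 : ‖patPt m i‖ ^ 2 = 1 := by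
        rw [norm_sq_fin3, patPt_apply', patPt_apply', patPt_apply']
        have ht := htab i
        unfold dotZ at ht
        rw [Fin.sum_univ_three] at ht
        have ht' : ((m.tab i 0 * m.tab i 0 + m.tab i 1 * m.tab i 1 + m.tab i 2 * m.tab i 2 : ℤ) : ℝ) =
            (m.normSq : ℝ) := by exact_mod_cast ht
        push_cast at ht'
        rw [← hsN2] at ht'
        field_simp
        nlinarith [ht']
      nlinarith [h2, norm_nonneg (patPt m i)]
    have hAu : ‖A (patPt m i)‖ = 1 := by rw [LinearIsometryEquiv.norm_map, hu1]
    have hnorm : ‖r i‖ = ‖p i - A (patPt m i)‖ := by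
      show ‖A.symm (p i) - patPt m i‖ = _
      rw [← LinearIsometryEquiv.norm_map A, map_sub, LinearIsometryEquiv.apply_symm_apply]
    have hsq : ‖p i - A (patPt m i)‖ ^ 2 = 2 - 2 * ⟪p i, A (patPt m i)⟫ := by
      rw [@norm_sub_sq_real, hp1 i, hAu]; ring
    have hkey : 1 - α ^ 2 / 2 ≤ ⟪p i, A (patPt m i)⟫ := by
      have h1 : (n : ℝ) * ((SC : ℝ) * sN * (1 - α ^ 2 / 2)) ≤
          (SC : ℝ) * (⟪p i, A (patPt m i)⟫ * (n * sN)) := by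
        rw [hF0i i]
        exact (mul_le_mul_of_nonneg_left hF0 hn0.le).trans (hL.f0 i)
      have h2 : (1 - α ^ 2 / 2) * ((n : ℝ) * SC * sN) ≤ ⟪p i, A (patPt m i)⟫ * ((n : ℝ) * SC * sN) := by
        nlinarith [h1]
      exact le_of_mul_le_mul_right h2 (by positivity)
    have hsq' : ‖r i‖ ^ 2 ≤ α ^ 2 := by rw [hnorm, hsq]; nlinarith [hkey]
    exact (pow_le_pow_iff_left₀ (norm_nonneg _) hα two_ne_zero).1 hsq'
  -- (F1): the coordinates of `lsRotL r` are `W_c(X)/(8 n √N)`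
  have hcr0 : ∀ i, (cross (patPt m i) (r i)) 0 = (∑ b, (fitObjW m Mq 0 i b : ℝ) * X i b) / (n * sN) := by
    intro i
    rw [cross_apply_zero, hrc, hrc, patPt_apply', patPt_apply']
    simp only [Fin.sum_univ_three, fitObjW, crossZ_apply_zero, hRe]
    push_cast
    field_simp
    ring
  have hcr1 : ∀ i, (cross (patPt m i) (r i)) 1 = (∑ b, (fitObjW m Mq 1 i b : ℝ) * X i b) / (n * sN) := by
    intro i
    rw [cross_apply_one, hrc, hrc, patPt_apply', patPt_apply']
    simp only [Fin.sum_univ_three, fitObjW, crossZ_apply_one, hRe]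
    push_cast
    field_simp
    ring
  have hcr2 : ∀ i, (cross (patPt m i) (r i)) 2 = (∑ b, (fitObjW m Mq 2 i b : ℝ) * X i b) / (n * sN) := by
    intro i
    rw [cross_apply_two, hrc, hrc, patPt_apply', patPt_apply']
    simp only [Fin.sum_univ_three, fitObjW, crossZ_apply_two, hRe]
    push_cast
    field_simp
    ring
  have hcr : ∀ i c, (cross (patPt m i) (r i)) c = (∑ b, (fitObjW m Mq c i b : ℝ) * X i b) / (n * sN) := by
    intro i c
    fin_cases c
    · exact hcr0 i
    · exact hcr1 i
    · exact hcr2 i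
  have hWdef : ∀ c, (lsRotL m r) c = fval (fitObjW m Mq c) X / (8 * n * sN) := by
    intro c
    unfold lsRotL
    rw [PiLp.smul_apply, finset_sum_apply, smul_eq_mul]
    simp only [hcr]
    rw [← Finset.sum_div]
    unfold fval
    field_simp
  have hW2 : (fval (fitObjW m Mq 0) X) ^ 2 + (fval (fitObjW m Mq 1) X) ^ 2 + (fval (fitObjW m Mq 2) X) ^ 2 ≤
      64 * (n : ℝ) ^ 2 * m.normSq * Ω ^ 2 := by
    obtain ⟨B, hB, hsum⟩ := hL.f1
    have h1 : ∀ c, ((SC : ℝ) * fval (fitObjW m Mq c) X) ^ 2 ≤ (B c : ℝ) ^ 2 := fun c => by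
      have h := hB c
      rw [abs_le] at h
      nlinarith [h.1, h.2]
    have h2 : (B 0 : ℝ) ^ 2 + (B 1 : ℝ) ^ 2 + (B 2 : ℝ) ^ 2 ≤ (n : ℝ) ^ 2 * prm.OM2 := by
      have : ((∑ k, B k ^ 2 : ℤ) : ℝ) ≤ ((n ^ 2 * prm.OM2 : ℤ) : ℝ) := by exact_mod_cast hsum
      push_cast at this
      rw [Fin.sum_univ_three] at this
      exact this
    have h3 : (n : ℝ) ^ 2 * prm.OM2 ≤ (n : ℝ) ^ 2 * (64 * m.normSq * Ω ^ 2 * (SC : ℝ) ^ 2) :=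
      mul_le_mul_of_nonneg_left hOM (sq_nonneg _)
    have h4 : (SC : ℝ) ^ 2 * ((fval (fitObjW m Mq 0) X) ^ 2 + (fval (fitObjW m Mq 1) X) ^ 2 +
        (fval (fitObjW m Mq 2) X) ^ 2) ≤ (SC : ℝ) ^ 2 * (64 * (n : ℝ) ^ 2 * m.normSq * Ω ^ 2) := by
      have e : (SC : ℝ) ^ 2 * ((fval (fitObjW m Mq 0) X) ^ 2 + (fval (fitObjW m Mq 1) X) ^ 2 +
          (fval (fitObjW m Mq 2) X) ^ 2) = ((SC : ℝ) * fval (fitObjW m Mq 0) X) ^ 2 +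
          ((SC : ℝ) * fval (fitObjW m Mq 1) X) ^ 2 + ((SC : ℝ) * fval (fitObjW m Mq 2) X) ^ 2 := by ring
      rw [e]
      have e' : (SC : ℝ) ^ 2 * (64 * (n : ℝ) ^ 2 * m.normSq * Ω ^ 2) =
          (n : ℝ) ^ 2 * (64 * m.normSq * Ω ^ 2 * (SC : ℝ) ^ 2) := by ring
      rw [e']
      linarith [h1 0, h1 1, h1 2, h2, h3]
    exact le_of_mul_le_mul_left h4 (by positivity)
  have hG1 : ‖lsRotL m r‖ ≤ Ω := by
    have hsq : ‖lsRotL m r‖ ^ 2 ≤ Ω ^ 2 := by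
      rw [norm_sq_fin3, hWdef 0, hWdef 1, hWdef 2, div_pow, div_pow, div_pow, ← add_div, ← add_div,
        div_le_iff₀ (by positivity)]
      have : (8 * (n : ℝ) * sN) ^ 2 = 64 * (n : ℝ) ^ 2 * m.normSq := by rw [← hsN2]; ring
      rw [this]
      calc (fval (fitObjW m Mq 0) X) ^ 2 + (fval (fitObjW m Mq 1) X) ^ 2 + (fval (fitObjW m Mq 2) X) ^ 2
          ≤ 64 * (n : ℝ) ^ 2 * m.normSq * Ω ^ 2 := hW2
        _ = Ω ^ 2 * (64 * (n : ℝ) ^ 2 * m.normSq) := by ring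
    exact (pow_le_pow_iff_left₀ (norm_nonneg _) hΩ two_ne_zero).1 hsq
  -- (F2)/(F3): the probe identity
  have hinner : ∀ (mv : Fin 3 → ℤ) (i : Fin 12), ⟪intVec mv, derotL m r i⟫ =
      fval (fitObj2 m Mq mv i) X / (8 * n * m.normSq) - (dotZ mv (m.tab i) : ℝ) / sN := by
    intro mv i
    rw [inner_fin3, fval_fitObj2]
    unfold derotL
    simp only [PiLp.sub_apply, cross_apply_zero, cross_apply_one, cross_apply_two, hWdef, hrc, patPt_apply',
      intVec_apply, mulVecZ, crossZ_apply_zero, crossZ_apply_one, crossZ_apply_two, dotZ,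
      Fin.sum_univ_three, hRe]
    rw [← hsN]
    push_cast
    rw [← hsN2]
    field_simp
    ring
  have hG2 : ∀ e ∈ prm.ptab, ∀ i, ⟪probeVec e, derotL m r i⟫ ≤ V₁ := by
    intro e he i
    obtain ⟨hk, hf⟩ := hL.f2 e he
    have hk0 : (0 : ℝ) < (e.2 : ℝ) := by exact_mod_cast pos_of_kOK hk
    have hsk0 : 0 < Real.sqrt e.2 := Real.sqrt_pos.2 hk0
    calc ⟪probeVec e, derotL m r i⟫ = (Real.sqrt e.2)⁻¹ * ⟪intVec e.1, derotL m r i⟫ := by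
          unfold probeVec; rw [real_inner_smul_left]
      _ = (Real.sqrt e.2)⁻¹ * (fval (fitObj2 m Mq e.1 i) X / (8 * n * m.normSq) -
            (dotZ e.1 (m.tab i) : ℝ) / sN) := by rw [hinner]
      _ ≤ V₁ := probe_row_bound hN hL.npos hsk0 (hf i) (hV1 e.2 hk)
  have hG3 : ∀ e ∈ prm.ptab, ∀ q ∈ bondPairs m, ⟪probeVec e, derotL m r q.1 - derotL m r q.2⟫ ≤ V₃ := by
    intro e he q hq
    obtain ⟨hk, hf⟩ := hL.f3 e he
    have hk0 : (0 : ℝ) < (e.2 : ℝ) := by exact_mod_cast pos_of_kOK hk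
    have hsk0 : 0 < Real.sqrt e.2 := Real.sqrt_pos.2 hk0
    have hfq := hf q hq
    rw [fval_fitObj3] at hfq
    have hΦ : ⟪intVec e.1, derotL m r q.1 - derotL m r q.2⟫ =
        (fval (fitObj2 m Mq e.1 q.1) X - fval (fitObj2 m Mq e.1 q.2) X) / (8 * n * m.normSq) -
          (dotZ e.1 (fun k => m.tab q.1 k - m.tab q.2 k) : ℝ) / sN := by
      rw [inner_sub_right, hinner, hinner, dotZ_sub]
      push_cast
      ring
    calc ⟪probeVec e, derotL m r q.1 - derotL m r q.2⟫ =
          (Real.sqrt e.2)⁻¹ * ⟪intVec e.1, derotL m r q.1 - derotL m r q.2⟫ := by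
          unfold probeVec; rw [real_inner_smul_left]
      _ = (Real.sqrt e.2)⁻¹ * ((fval (fitObj2 m Mq e.1 q.1) X - fval (fitObj2 m Mq e.1 q.2) X) /
            (8 * n * m.normSq) - (dotZ e.1 (fun k => m.tab q.1 k - m.tab q.2 k) : ℝ) / sN) := by rw [hΦ]
      _ ≤ V₃ := probe_row_bound hN hL.npos hsk0 hfq (hV3 e.2 hk)
  exact ⟨hG0, hG1, hG2, hG3⟩

end Rig

end Summit.AtomisticToContinuum.Crystallization.Theorems
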